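import Literature.Probability.RandomPlanarGeometry.SAWBridgeSpanGF
import Mathlib.Analysis.SpecialFunctions.Pow.Asymptotics
import HarnessLib

/-!
# Quantitative Hammersley–Welsh from quantitative bridge sub-ballisticity, I: Hutchcroft 2018,
# hypothesis (1.1) (repaired), Lemma 2.4 and Theorem 1.4 — power-law rate, finite form

Topic `Literature/Probability/RandomPlanarGeometry` (continues `SAWBridgeSpanGF.lean`). Source:
T. Hutchcroft, Electron. Commun. Probab. 23 (2018) no. 5 (arXiv:1708.09460), §1 eq. (1.1), Theorem 1.4,
Corollary 1.5, §2.2 Lemma 2.4. Printed: Theorem 1.3 (= Duminil-Copin–Hammond 2013), eq. (1.1):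
"`Σ_ω 1[ω : 0 → ℤ^{d-1} × {m, m+1, …} is a length n SAB] ≤ b_n exp[-φ(m/n) n]` for all `n ≥ m > 0`";
Lemma 2.4: "`ξ((1-ε)z_c) ≥ -ψ(ε) log(1-ε)`", proved via (2.4) "`ξ((1-ε)z_c) ≥ min{-λ log(1-ε),
-log(1-ε) + Φ(λ^{-1})}` for every `ε > 0` and `λ ≥ 1`"; Theorem 1.4: "`c_n ≤ exp[Ψ(n) - 2] μ_c^{n+1}`
for every `n ≥ 0`"; Corollary 1.5: "suppose that `φ(ε) = C ε^ν` satisfies (1.1) for some `ν > 1` and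
`C > 0`. Then `c_n ≤ exp[O(n^{(ν-1)/(2ν-1)})] μ_c^n`."

READING NOTE (lane pcv-sawmu; lit-1, 2026-08-21). AS PRINTED, (1.1) with any `φ > 0` is FALSE at
`n = m = 1`: every bridge has height `≥ 1`, so the left side is `b_1` (Duminil-Copin–Hammond's theorem is
asymptotic in `n`). What the proof of Theorem 1.4 consumes is (1.1) up to a constant PREFACTOR: the
hypothesis enters only through the Fekete rate of the span-`n` generating function `a(z;n)`
(Lemma 2.4), where prefactors — like Hutchcroft's own factor `λn` — vanish. We therefore type the
hypothesis WITH A PREFACTOR `A` (`BridgeHeightDecay d ν A C`, power-law `φ(ε) = Cε^ν` as in Cor. 1.5)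
and prove Theorem 1.4 / Corollary 1.5 under it; conclusions are the printed ones (here: the finite form
before optimising in `ε`; `SAWQuantitativeHWCor.lean`: the `exp[O(n^{(ν-1)/(2ν-1)})]` form with an
explicit constant). The hypothesis itself is OPEN on `ℤ^d` for every `ν` (DC–H give a positive rate of
unknown form); the implication is the content. Hutchcroft's real `λ ≥ 1` is an integer `ℓ ≥ 1` here.

## Contents (namespace `Literature.Probability.RandomPlanarGeometry.SAW.Zd`; all PROVED but the defs)

* `BridgeHeightDecay d ν A C` — the repaired hypothesis (1.1) with `φ(ε) = Cε^ν`; `BridgeHeightDecay.nonneg`;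
* `BridgeHeightDecayWindow d ℓ A c` — its WINDOWED consumption (lengths `n ≤ m ≤ ℓn`, rate `c n`), which is
  all the proof of Lemma 2.4 uses; `BridgeHeightDecay.window` (power law ⇒ window at every `ℓ`, `c = Cℓ^{1-ν}`);
* **`brGF_subcrit_le`** — Lemma 2.4, finite form: for `z = (1-ε)z_c`, span `n ≥ 1`, window `ℓ`, any `M`,
  `V_M(z;n) ≤ (1-ε)^{ℓn} + (ℓn+1) · A · (1-ε)^n · e^{-c n}`;
* **`brGF_subcrit_le_pow`** — the rate (2.4): `V_M(z;n) ≤ ρ^n`, `ρ = max((1-ε)^ℓ, (1-ε) e^{-c})`, by Fekete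
  in the span (`le_of_pow_le`: `x^k ≤ c k r^k ∀k ⇒ x ≤ r`) — here the prefactor `A` disappears;
* **`count_le_of_heightDecayWindow`**, **`count_le_of_heightDecay`** — Theorem 1.4 before optimising in
  `ε`: `c_N ≤ exp(2ρ/(1-ρ)) · μ^{N+1} / (1-ε)^{N+1}` for all `0 < ε < 1`, `ℓ ≥ 1`, `N` (window form, and
  power-law form with `c = Cℓ^{1-ν}`; Hutchcroft's `[1-(1-ε)^{ψ(ε)}]^{-1}` is our `1/(1-ρ)`).
-/

noncomputable section

open Finset Filter Topology Literature.Probability.LatticeModels Literature.Probability.Percolation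
open scoped BigOperators

namespace Literature.Probability.RandomPlanarGeometry.SAW.Zd

variable {d : ℕ} [NeZero d]

/-! ### §C. The repaired hypothesis and Lemma 2.4 (power-law case), finite form -/

/-- **Quantitative bridge sub-ballisticity with a power-law rate** — Hutchcroft's hypothesis (1.1)
with `φ(ε) = C ε^ν` (the case of Corollary 1.5), READ WITH A PREFACTOR `A`:
`∀ n ≥ m > 0, #{ω ∈ bridges d n : m ≤ ω n 0} ≤ A · b_n · exp(-C (m/n)^ν n)`
(`bridges d n`: Madras–Slade bridges in the FIRST coordinate, started at `0`, so the endpoint level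
`ω n 0` is the maximal level = the "height reached"). As printed ((1.1): no prefactor) the hypothesis is
false at `n = m = 1` for every `C > 0` (every bridge has height `≥ 1`); the prefactor is what the
proof of Theorem 1.4 actually tolerates (it enters only the Fekete rate, see `brGF_subcrit_le_pow`).
Open on `ℤ^d` for every `ν`; Duminil-Copin–Hammond 2013 give SOME positive rate with no form.
[cite: Hutchcroft2018HammersleyWelsh, eq. (1.1) and Corollary 1.5 (hypothesis, repaired reading)] -/
def BridgeHeightDecay (d : ℕ) [NeZero d] (ν A C : ℝ) : Prop :=
  ∀ n m : ℕ, 0 < m → m ≤ n →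
    (((bridges d n).filter fun ω => (m : ℤ) ≤ ω n 0).card : ℝ) ≤
      A * (bridgeCount d n : ℝ) * Real.exp (-(C * ((m : ℝ) / n) ^ ν * n))

/-- The prefactor of `BridgeHeightDecay` is nonnegative (test at `n = m = 1`).
[cite: Hutchcroft2018HammersleyWelsh, eq. (1.1)] -/
theorem BridgeHeightDecay.nonneg {ν A C : ℝ} (h : BridgeHeightDecay d ν A C) : 0 ≤ A := by
  have aux : ∀ X b e : ℝ, 0 ≤ X → X ≤ A * b * e → 0 < b → 0 < e → 0 ≤ A := by
    intro X b e hX hle hb he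
    by_contra hA
    push Not at hA
    have : A * b * e < 0 := mul_neg_of_neg_of_pos (mul_neg_of_neg_of_pos hA hb) he
    linarith
  exact aux _ _ _ (Nat.cast_nonneg _) (h 1 1 one_pos le_rfl)
    (by exact_mod_cast one_le_bridgeCount (d := d) 1) (Real.exp_pos _)

/-- Bridges of span `n` and length `m ≤ ℓ n` (`n ≥ 1`): the rate `C (n/m)^ν m = C (n/m)^{ν-1} n` is at
least `C ℓ^{1-ν} n` ("`-log(1-ε) + Φ(λ^{-1})`" with `Φ(ε) = C ε^{ν-1}` for `φ(ε) = C ε^ν`). [folklore] -/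
private theorem rate_lower_bound {ν : ℝ} (hν : 1 ≤ ν) {n m ℓ : ℕ} (hn : 1 ≤ n) (hnm : n ≤ m)
    (hmℓ : m ≤ ℓ * n) : ((ℓ : ℝ)) ^ (1 - ν) * n ≤ ((n : ℝ) / m) ^ ν * m := by
  have hn0 : (0 : ℝ) < n := by exact_mod_cast hn
  have hm0 : (0 : ℝ) < m := by exact_mod_cast (lt_of_lt_of_le hn hnm)
  have hℓ1 : 1 ≤ ℓ := by
    by_contra h
    push Not at h
    have : ℓ = 0 := by omega
    subst this
    simp at hmℓ
    omega
  have hℓ0 : (0 : ℝ) < ℓ := by exact_mod_cast hℓ1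
  have hq0 : (0 : ℝ) < (n : ℝ) / m := div_pos hn0 hm0
  -- `(n/m)^ν m = (n/m)^{ν-1} n`
  have h1 : ((n : ℝ) / m) ^ ν * m = ((n : ℝ) / m) ^ (ν - 1) * n := by
    conv_lhs => rw [show ν = (ν - 1) + 1 by ring, Real.rpow_add hq0, Real.rpow_one]
    field_simp
  -- `ℓ^{1-ν} = (1/ℓ)^{ν-1} ≤ (n/m)^{ν-1}`
  have h2 : ((ℓ : ℝ)) ^ (1 - ν) = ((1 : ℝ) / ℓ) ^ (ν - 1) := by
    rw [one_div, Real.inv_rpow hℓ0.le, ← Real.rpow_neg hℓ0.le, neg_sub]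
  have h3 : (1 : ℝ) / ℓ ≤ (n : ℝ) / m := by
    rw [div_le_div_iff₀ hℓ0 hm0]
    have : ((m : ℕ) : ℝ) ≤ ((ℓ * n : ℕ) : ℝ) := by exact_mod_cast hmℓ
    push_cast at this
    calc (1 : ℝ) * m = m := one_mul _
      _ ≤ (ℓ : ℝ) * n := this
      _ = n * ℓ := mul_comm _ _
  rw [h1, h2]
  exact mul_le_mul_of_nonneg_right (Real.rpow_le_rpow (by positivity) h3 (by linarith)) hn0.le

/-- **Windowed bridge height decay** at aspect ratio `1/ℓ` with rate `c` and prefactor `A`: every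
length `m` with `n ≤ m ≤ ℓ n` (`n ≥ 1`) satisfies `#{ω ∈ bridges d m : n ≤ ω m 0} ≤ A · b_m · e^{-c n}`.
This is exactly how hypothesis (1.1) is CONSUMED in the proof of Lemma 2.4 (lengths `m ∈ [n, λn]`,
rate `Φ(λ^{-1}) n`): the power law `φ(ε) = Cε^ν` gives it with `c = C ℓ^{1-ν}`
(`BridgeHeightDecay.window`), and Duminil-Copin–Hammond's qualitative Theorem 1.3 gives, for every
`ℓ`, SOME `c > 0`. [cite: Hutchcroft2018HammersleyWelsh, eq. (1.1) and proof of Lemma 2.4 (windowed reading)] -/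
def BridgeHeightDecayWindow (d : ℕ) [NeZero d] (ℓ : ℕ) (A c : ℝ) : Prop :=
  ∀ m n : ℕ, 1 ≤ n → n ≤ m → m ≤ ℓ * n →
    (((bridges d m).filter fun ω => (n : ℤ) ≤ ω m 0).card : ℝ) ≤
      A * (bridgeCount d m : ℝ) * Real.exp (-(c * n))

/-- The prefactor of a (nonempty, `ℓ ≥ 1`) window hypothesis is nonnegative (test at `m = n = 1`).
[cite: Hutchcroft2018HammersleyWelsh, eq. (1.1)] -/
theorem BridgeHeightDecayWindow.nonneg {ℓ : ℕ} {A c : ℝ} (h : BridgeHeightDecayWindow d ℓ A c)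
    (hℓ : 1 ≤ ℓ) : 0 ≤ A := by
  have aux : ∀ X b e : ℝ, 0 ≤ X → X ≤ A * b * e → 0 < b → 0 < e → 0 ≤ A := by
    intro X b e hX hle hb he
    by_contra hA
    push Not at hA
    have : A * b * e < 0 := mul_neg_of_neg_of_pos (mul_neg_of_neg_of_pos hA hb) he
    linarith
  exact aux _ _ _ (Nat.cast_nonneg _) (h 1 1 le_rfl le_rfl (by omega))
    (by exact_mod_cast one_le_bridgeCount (d := d) 1) (Real.exp_pos _)

/-- **Power-law height decay gives every window**, with rate `c = C ℓ^{1-ν}`: for `n ≤ m ≤ ℓ n`,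
`C (n/m)^ν m ≥ C ℓ^{1-ν} n` (`Φ(ε) ≥ C ε^{ν-1}` in the proof of Corollary 1.5).
[cite: Hutchcroft2018HammersleyWelsh, proof of Corollary 1.5 ("`Φ(ε) ≥ Cε^{ν-1}`")] -/
theorem BridgeHeightDecay.window {ν A C : ℝ} (h : BridgeHeightDecay d ν A C) (hν : 1 ≤ ν)
    (hC : 0 ≤ C) (ℓ : ℕ) : BridgeHeightDecayWindow d ℓ A (C * (ℓ : ℝ) ^ (1 - ν)) := by
  intro m n hn hnm hmℓ
  refine (h m n hn hnm).trans ?_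
  have hA : 0 ≤ A := h.nonneg
  refine mul_le_mul_of_nonneg_left ?_ (by positivity)
  rw [Real.exp_le_exp, neg_le_neg_iff, mul_assoc, mul_assoc]
  exact mul_le_mul_of_nonneg_left (rate_lower_bound hν hn hnm hmℓ) hC

/-- **Lemma 2.4, finite form.** Under the window hypothesis `BridgeHeightDecayWindow d ℓ A c`
(`ℓ ≥ 1`), for `0 < ε < 1`, `z = (1-ε) z_c`, a span `n ≥ 1` and every truncation `M`:
`V_M(z;n) ≤ (1-ε)^{ℓn} + (ℓn+1) · A · (1-ε)^n · e^{-c n}`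
— lengths `m > ℓn` contribute `≤ (1-ε)^{ℓn} a(z_c;n) ≤ (1-ε)^{ℓn}` (Lemma 2.3); lengths `n ≤ m ≤ ℓn`
contribute `≤ (1-ε)^m z_c^m b_m A e^{-c n} ≤ A (1-ε)^n e^{-c n}` each (`b_m ≤ μ^m`); `ℓ` is
Hutchcroft's `λ` (an integer here), `c n` his `Φ(λ^{-1}) n`.
[cite: Hutchcroft2018HammersleyWelsh, Lemma 2.4 (proof, display after "This implies that")] -/
theorem brGF_subcrit_le {ℓ : ℕ} {A c : ℝ} (h : BridgeHeightDecayWindow d ℓ A c) (hℓ : 1 ≤ ℓ)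
    {ε : ℝ} (hε0 : 0 < ε) (hε1 : ε < 1) {n : ℕ} (hn : 1 ≤ n) (M : ℕ) :
    brGF d M ((1 - ε) * (connectiveConstant d)⁻¹) n ≤
      (1 - ε) ^ (ℓ * n) +
        ((ℓ * n + 1 : ℕ) : ℝ) * A * (1 - ε) ^ n * Real.exp (-(c * n)) := by
  classical
  have hμ := connectiveConstant_pos d
  set zc : ℝ := (connectiveConstant d)⁻¹ with hzc
  have hzc0 : 0 < zc := inv_pos.2 hμ
  have hA := h.nonneg hℓ
  have h1ε : 0 ≤ 1 - ε := by linarith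
  have h1ε1 : 1 - ε ≤ 1 := by linarith
  set g : ℝ := A * (1 - ε) ^ n * Real.exp (-(c * n)) with hg
  have hg0 : 0 ≤ g := by positivity
  -- the summand
  set f : ℕ → ℝ := fun m => ((brSpan d m (n : ℤ)).card : ℝ) * ((1 - ε) * zc) ^ m with hf
  have hf0 : ∀ m, 0 ≤ f m := fun m => by positivity
  have hsplit : brGF d M ((1 - ε) * zc) n =
      ∑ m ∈ (Finset.range (M + 1)).filter (fun m => m ≤ ℓ * n), f m +
        ∑ m ∈ (Finset.range (M + 1)).filter (fun m => ¬ m ≤ ℓ * n), f m := by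
    rw [brGF, Finset.sum_filter_add_sum_filter_not]
  -- TAIL: lengths `m > ℓ n`
  have htail : ∑ m ∈ (Finset.range (M + 1)).filter (fun m => ¬ m ≤ ℓ * n), f m ≤ (1 - ε) ^ (ℓ * n) := by
    calc ∑ m ∈ (Finset.range (M + 1)).filter (fun m => ¬ m ≤ ℓ * n), f m
        ≤ ∑ m ∈ (Finset.range (M + 1)).filter (fun m => ¬ m ≤ ℓ * n),
            (1 - ε) ^ (ℓ * n) * (((brSpan d m (n : ℤ)).card : ℝ) * zc ^ m) := by
          refine Finset.sum_le_sum fun m hm => ?_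
          rw [Finset.mem_filter] at hm
          have hle : (1 - ε) ^ m ≤ (1 - ε) ^ (ℓ * n) := pow_le_pow_of_le_one h1ε h1ε1 (by omega)
          rw [hf]
          dsimp only
          rw [mul_pow]
          calc ((brSpan d m (n : ℤ)).card : ℝ) * ((1 - ε) ^ m * zc ^ m)
              = (1 - ε) ^ m * (((brSpan d m (n : ℤ)).card : ℝ) * zc ^ m) := by ring
            _ ≤ (1 - ε) ^ (ℓ * n) * (((brSpan d m (n : ℤ)).card : ℝ) * zc ^ m) :=
                mul_le_mul_of_nonneg_right hle (by positivity)
      _ = (1 - ε) ^ (ℓ * n) * ∑ m ∈ (Finset.range (M + 1)).filter (fun m => ¬ m ≤ ℓ * n),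
            ((brSpan d m (n : ℤ)).card : ℝ) * zc ^ m := by rw [Finset.mul_sum]
      _ ≤ (1 - ε) ^ (ℓ * n) * brGF d M zc n := by
          refine mul_le_mul_of_nonneg_left ?_ (pow_nonneg h1ε _)
          rw [brGF]
          exact Finset.sum_le_sum_of_subset_of_nonneg (Finset.filter_subset _ _)
            fun m _ _ => by positivity
      _ ≤ (1 - ε) ^ (ℓ * n) * 1 :=
          mul_le_mul_of_nonneg_left (brGF_critical_le_one M (n : ℤ)) (pow_nonneg h1ε _)
      _ = (1 - ε) ^ (ℓ * n) := mul_one _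
  -- HEAD: lengths `m ≤ ℓ n`; each term is `≤ g` (and `= 0` unless `m ≥ n`)
  have hterm : ∀ m, m ≤ ℓ * n → f m ≤ g := by
    intro m hmℓ
    rcases lt_or_ge m n with hmn | hmn
    · -- span `n` > length `m`: no such bridge
      have : (brSpan d m (n : ℤ)).card = 0 := by
        rw [Finset.card_eq_zero, Finset.eq_empty_iff_forall_notMem]
        intro ω hω
        obtain ⟨hωb, hωn⟩ := mem_brSpan.1 hω
        obtain ⟨h00, -, hadj, -⟩ := mem_saws.1 (mem_bridges.1 hωb).1
        have hb := abs_apply_le_of_adj h00 hadj m le_rfl 0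
        rw [hωn] at hb
        have : (n : ℤ) ≤ m := (le_abs_self _).trans hb
        omega
      rw [hf]; dsimp only; rw [this, Nat.cast_zero, zero_mul]; exact hg0
    · -- `#brSpan(m,n) ≤ #{height ≥ n} ≤ A b_m e^{-c n}`
      have hcard : ((brSpan d m (n : ℤ)).card : ℝ) ≤
          A * (bridgeCount d m : ℝ) * Real.exp (-(c * n)) := by
        refine le_trans ?_ (h m n hn hmn hmℓ)
        exact_mod_cast Finset.card_le_card (fun ω hω => by
          rw [Finset.mem_filter]
          obtain ⟨hωb, hωn⟩ := mem_brSpan.1 hω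
          exact ⟨hωb, hωn.ge⟩)
      have hbz : (bridgeCount d m : ℝ) * zc ^ m ≤ 1 := by
        calc (bridgeCount d m : ℝ) * zc ^ m ≤ connectiveConstant d ^ m * zc ^ m :=
              mul_le_mul_of_nonneg_right (bridgeCount_le_pow m) (pow_nonneg hzc0.le m)
          _ = 1 := by rw [← mul_pow, hzc, mul_inv_cancel₀ hμ.ne', one_pow]
      have hpow : (1 - ε) ^ m ≤ (1 - ε) ^ n := pow_le_pow_of_le_one h1ε h1ε1 hmn
      rw [hf]; dsimp only
      rw [mul_pow]
      calc ((brSpan d m (n : ℤ)).card : ℝ) * ((1 - ε) ^ m * zc ^ m)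
          ≤ (A * (bridgeCount d m : ℝ) * Real.exp (-(c * n))) * ((1 - ε) ^ m * zc ^ m) :=
            mul_le_mul_of_nonneg_right hcard (by positivity)
        _ = A * ((bridgeCount d m : ℝ) * zc ^ m) * (1 - ε) ^ m * Real.exp (-(c * n)) := by ring
        _ ≤ A * 1 * (1 - ε) ^ n * Real.exp (-(c * n)) := by gcongr
        _ = g := by rw [hg, mul_one]
  have hhead : ∑ m ∈ (Finset.range (M + 1)).filter (fun m => m ≤ ℓ * n), f m ≤
      ((ℓ * n + 1 : ℕ) : ℝ) * g := by
    calc ∑ m ∈ (Finset.range (M + 1)).filter (fun m => m ≤ ℓ * n), f m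
        ≤ ∑ m ∈ Finset.range (ℓ * n + 1), f m := by
          refine Finset.sum_le_sum_of_subset_of_nonneg ?_ fun m _ _ => hf0 m
          intro m hm
          rw [Finset.mem_filter] at hm
          rw [Finset.mem_range]; omega
      _ ≤ ∑ _m ∈ Finset.range (ℓ * n + 1), g :=
          Finset.sum_le_sum fun m hm => hterm m (Nat.le_of_lt_succ (Finset.mem_range.1 hm))
      _ = ((ℓ * n + 1 : ℕ) : ℝ) * g := by
          rw [Finset.sum_const, Finset.card_range, nsmul_eq_mul]
  rw [hsplit, hg] at *
  calc _ ≤ ((ℓ * n + 1 : ℕ) : ℝ) * (A * (1 - ε) ^ n * Real.exp (-(c * n))) +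
        (1 - ε) ^ (ℓ * n) := add_le_add hhead htail
    _ = _ := by ring

/-! ### §D. Fekete in the span: `a((1-ε)z_c; n) ≤ ρ^n`; Theorem 1.4 -/

/-- Fekete-type extraction of a rate: if `x^k ≤ c · k · r^k` for all `k ≥ 1` (`r > 0`), then `x ≤ r`
(a polynomial prefactor does not affect the exponential rate). [folklore] -/
private theorem le_of_pow_le {x r c : ℝ} (hr : 0 < r)
    (h : ∀ k : ℕ, 1 ≤ k → x ^ k ≤ c * k * r ^ k) : x ≤ r := by
  by_contra hxr
  push Not at hxr
  have hx : 0 < x := hr.trans hxr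
  set q : ℝ := r / x with hq
  have hq0 : 0 < q := div_pos hr hx
  have hq1 : q < 1 := (div_lt_one hx).2 hxr
  have hrq : r = q * x := by rw [hq, div_mul_cancel₀ _ hx.ne']
  have ht : Tendsto (fun n : ℕ => c * (((n : ℝ)) ^ 1 * q ^ n)) atTop (𝓝 (c * 0)) :=
    (tendsto_pow_const_mul_const_pow_of_abs_lt_one 1
      (by rw [abs_of_pos hq0]; exact hq1)).const_mul c
  rw [mul_zero] at ht
  obtain ⟨n, hn⟩ := (ht.eventually (eventually_lt_nhds zero_lt_one)).exists_forall_of_atTop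
  set k : ℕ := max n 1 with hk
  have key := h k (le_max_right _ _)
  have hlt := hn k (le_max_left _ _)
  have hxk : 0 < x ^ k := pow_pos hx _
  rw [hrq, mul_pow] at key
  have h1 : c * (k : ℝ) * (q ^ k * x ^ k) = (c * (((k : ℝ)) ^ 1 * q ^ k)) * x ^ k := by ring
  rw [h1] at key
  have h2 : (c * (((k : ℝ)) ^ 1 * q ^ k)) * x ^ k < 1 * x ^ k := mul_lt_mul_of_pos_right hlt hxk
  linarith

/-- **`a((1-ε)z_c; n) ≤ ρ^n` for every span `n ≥ 1` and every truncation** (Lemma 2.4 made into a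
rate by Fekete's lemma in the span variable): under the window hypothesis at `ℓ ≥ 1` with rate `c`,
`V_M((1-ε)z_c; n) ≤ ρ^n` with `ρ = max((1-ε)^ℓ, (1-ε) e^{-c})` — from
`V_M(n)^k ≤ V_{kM}(kn) ≤ (1 + (ℓkn+1)A) ρ^{kn}` (supermultiplicativity, Lemma 2.4 at span `kn`) and
`le_of_pow_le`; this is (2.4) "`ξ((1-ε)z_c) ≥ min{-λ log(1-ε), -log(1-ε) + Φ(λ^{-1})}`", `λ = ℓ`.
[cite: Hutchcroft2018HammersleyWelsh, Lemma 2.4, eq. (2.4) and eq. (2.2) ("`a(z;n) ≤ e^{-ξ(z)n}`")] -/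
theorem brGF_subcrit_le_pow {ℓ : ℕ} {A c : ℝ} (h : BridgeHeightDecayWindow d ℓ A c) (hℓ : 1 ≤ ℓ)
    {ε : ℝ} (hε0 : 0 < ε) (hε1 : ε < 1) (M : ℕ) {n : ℕ} (hn : 1 ≤ n) :
    brGF d M ((1 - ε) * (connectiveConstant d)⁻¹) n ≤
      (max ((1 - ε) ^ ℓ) ((1 - ε) * Real.exp (-c))) ^ n := by
  set ρ : ℝ := max ((1 - ε) ^ ℓ) ((1 - ε) * Real.exp (-c)) with hρ
  set z : ℝ := (1 - ε) * (connectiveConstant d)⁻¹ with hz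
  have hA := h.nonneg hℓ
  have h1ε : 0 < 1 - ε := by linarith
  have hz0 : 0 ≤ z := by
    have := connectiveConstant_pos d
    positivity
  have hρ0 : 0 < ρ := lt_max_of_lt_left (pow_pos h1ε ℓ)
  have hρ1 : (1 - ε) ^ ℓ ≤ ρ := le_max_left _ _
  have hρ2 : (1 - ε) * Real.exp (-c) ≤ ρ := le_max_right _ _
  refine le_of_pow_le (c := 1 + ((ℓ * n + 1 : ℕ) : ℝ) * A) (pow_pos hρ0 n) fun k hk => ?_
  have hkn : 1 ≤ k * n := Nat.mul_le_mul hk hn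
  have hcast : ((k : ℤ)) * (n : ℤ) = ((k * n : ℕ) : ℤ) := by push_cast; ring
  calc brGF d M z n ^ k ≤ brGF d (k * M) z (k * (n : ℤ)) := brGF_pow_le M hz0 n k
    _ = brGF d (k * M) z ((k * n : ℕ) : ℤ) := by rw [hcast]
    _ ≤ (1 - ε) ^ (ℓ * (k * n)) + ((ℓ * (k * n) + 1 : ℕ) : ℝ) * A * (1 - ε) ^ (k * n) *
          Real.exp (-(c * ((k * n : ℕ) : ℝ))) :=
        brGF_subcrit_le h hℓ hε0 hε1 hkn (k * M)
    _ ≤ ρ ^ (k * n) + ((ℓ * (k * n) + 1 : ℕ) : ℝ) * A * ρ ^ (k * n) := by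
        have e1 : (1 - ε) ^ (ℓ * (k * n)) ≤ ρ ^ (k * n) := by
          rw [pow_mul]
          exact pow_le_pow_left₀ (pow_nonneg h1ε.le ℓ) hρ1 _
        have e2 : (1 - ε) ^ (k * n) * Real.exp (-(c * ((k * n : ℕ) : ℝ))) ≤ ρ ^ (k * n) := by
          rw [show -(c * ((k * n : ℕ) : ℝ)) = ((k * n : ℕ) : ℝ) * (-c) by ring, Real.exp_nat_mul,
            ← mul_pow]
          exact pow_le_pow_left₀ (by positivity) hρ2 _
        calc (1 - ε) ^ (ℓ * (k * n)) + ((ℓ * (k * n) + 1 : ℕ) : ℝ) * A * (1 - ε) ^ (k * n) *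
              Real.exp (-(c * ((k * n : ℕ) : ℝ)))
            = (1 - ε) ^ (ℓ * (k * n)) + ((ℓ * (k * n) + 1 : ℕ) : ℝ) * A * ((1 - ε) ^ (k * n) *
              Real.exp (-(c * ((k * n : ℕ) : ℝ)))) := by ring
          _ ≤ ρ ^ (k * n) + ((ℓ * (k * n) + 1 : ℕ) : ℝ) * A * ρ ^ (k * n) := by
              gcongr
    _ = (1 + ((ℓ * (k * n) + 1 : ℕ) : ℝ) * A) * ρ ^ (k * n) := by ring
    _ ≤ ((1 + ((ℓ * n + 1 : ℕ) : ℝ) * A) * k) * ρ ^ (k * n) := by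
        refine mul_le_mul_of_nonneg_right ?_ (pow_nonneg hρ0.le _)
        have hk1 : (1 : ℝ) ≤ k := by exact_mod_cast hk
        have hcmp : ((ℓ * (k * n) + 1 : ℕ) : ℝ) ≤ ((ℓ * n + 1 : ℕ) : ℝ) * k := by
          have : ℓ * (k * n) + 1 ≤ (ℓ * n + 1) * k := by nlinarith
          exact_mod_cast this
        nlinarith [mul_nonneg (Nat.cast_nonneg (ℓ * n + 1)) hA]
    _ = (1 + ((ℓ * n + 1 : ℕ) : ℝ) * A) * k * (ρ ^ n) ^ k := by
        rw [← pow_mul, mul_comm n k]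

/-- **Theorem 1.4, explicit finite form.** Under the window hypothesis `BridgeHeightDecayWindow d ℓ A c`
(`ℓ ≥ 1`, `c ≥ 0`): for every `0 < ε < 1` and every `N`,
`c_N ≤ exp(2ρ/(1-ρ)) · μ^{N+1} / (1-ε)^{N+1}` with `ρ = max((1-ε)^ℓ, (1-ε) e^{-c}) < 1`
— Hutchcroft's `c_n ≤ exp[Ψ(n) - 2] μ_c^{n+1}` before optimising in `ε` (his `[1-(1-ε)^{ψ(ε)}]^{-1}`
is our `1/(1-ρ) = 1 + ρ/(1-ρ)`, the `-2` cancelling the span-`0` term `a(z;0) = 1`).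
[cite: Hutchcroft2018HammersleyWelsh, Theorem 1.4 (windowed/repaired hypothesis)] -/
theorem count_le_of_heightDecayWindow {ℓ : ℕ} {A c : ℝ} (h : BridgeHeightDecayWindow d ℓ A c)
    (hℓ : 1 ≤ ℓ) (hc : 0 ≤ c) {ε : ℝ} (hε0 : 0 < ε) (hε1 : ε < 1) (N : ℕ) :
    (count d N : ℝ) ≤
      Real.exp (2 * (max ((1 - ε) ^ ℓ) ((1 - ε) * Real.exp (-c)) /
        (1 - max ((1 - ε) ^ ℓ) ((1 - ε) * Real.exp (-c))))) *
        connectiveConstant d ^ (N + 1) / (1 - ε) ^ (N + 1) := by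
  set ρ : ℝ := max ((1 - ε) ^ ℓ) ((1 - ε) * Real.exp (-c)) with hρ
  have hμ := connectiveConstant_pos d
  have h1ε : 0 < 1 - ε := by linarith
  have hρ0 : 0 ≤ ρ := le_max_of_le_left (pow_nonneg h1ε.le ℓ)
  have hρ1 : ρ < 1 := by
    refine max_lt (pow_lt_one₀ h1ε.le (by linarith) (by omega)) ?_
    calc (1 - ε) * Real.exp (-c) ≤ (1 - ε) * 1 := by
          refine mul_le_mul_of_nonneg_left ?_ h1ε.le
          rw [Real.exp_le_one_iff, neg_nonpos]
          exact hc
      _ < 1 := by linarith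
  set z : ℝ := (1 - ε) * (connectiveConstant d)⁻¹ with hz
  have hz0 : 0 < z := by positivity
  have key := count_le_of_brGF_le hz0 hρ0 hρ1
    (fun M A' hA' => brGF_subcrit_le_pow h hℓ hε0 hε1 M hA') N
  have hzpow : z ^ (N + 1) = (1 - ε) ^ (N + 1) / connectiveConstant d ^ (N + 1) := by
    rw [hz, mul_pow, inv_pow, div_eq_mul_inv]
  rw [hzpow, div_div_eq_mul_div] at key
  exact key

/-- **Theorem 1.4, power-law case** (`BridgeHeightDecay d ν A C`, `ν ≥ 1`, `C ≥ 0`): for every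
`0 < ε < 1`, integer `ℓ ≥ 1` and `N`, `c_N ≤ exp(2ρ/(1-ρ)) · μ^{N+1} / (1-ε)^{N+1}` with
`ρ = max((1-ε)^ℓ, (1-ε) e^{-C ℓ^{1-ν}})` (the window at `ℓ` has rate `C ℓ^{1-ν}`).
[cite: Hutchcroft2018HammersleyWelsh, Theorem 1.4 (power-law `φ`, repaired hypothesis)] -/
theorem count_le_of_heightDecay {ν A C : ℝ} (h : BridgeHeightDecay d ν A C) (hν : 1 ≤ ν) (hC : 0 ≤ C)
    {ε : ℝ} (hε0 : 0 < ε) (hε1 : ε < 1) {ℓ : ℕ} (hℓ : 1 ≤ ℓ) (N : ℕ) :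
    (count d N : ℝ) ≤
      Real.exp (2 * (max ((1 - ε) ^ ℓ) ((1 - ε) * Real.exp (-(C * (ℓ : ℝ) ^ (1 - ν)))) /
        (1 - max ((1 - ε) ^ ℓ) ((1 - ε) * Real.exp (-(C * (ℓ : ℝ) ^ (1 - ν))))))) *
        connectiveConstant d ^ (N + 1) / (1 - ε) ^ (N + 1) :=
  count_le_of_heightDecayWindow (h.window hν hC ℓ) hℓ (by positivity) hε0 hε1 N

end Literature.Probability.RandomPlanarGeometry.SAW.Zd

end
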